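import Mathlib

/-!
# Toeplitz three-slot lemma (hidden-corner lemma, crux stmt-MatrixMultiplication-10752)

Support file for crux item `stmt-MatrixMultiplication-10752`
(`Summit.MatrixMultiplication.MatrixMultiplication.Theses.HiddenToeplitzCorners.HiddenCornerLemmaR`),
line `frobenius-dual-short-syzygies`, stub `stub_mixedLaw` (mixed compression classes `p, q ≥ 1`).

`hclR_toeplitz_three_slot`: if `T 0, T 1, T 2` are honest `N × N` Toeplitz matrices,
`E 0, E 1, E 2` arbitrary vectors and `T b *ᵥ E c = [b = c] • f` for all `b c : Fin 3`, then `f = 0`.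
Hence an honest Toeplitz pencil never hides a linearly explained corner with three or more slots
(used in `HiddenCornerLemmaRMixedToeplitz`: the mixed law holds with `r ≤ 2` whenever the constant
generators `G₀`, `H₀` are supported on row `0`).  The proof is the short-syzygy argument of the
line: a polynomial syzygy of the reversed frame polynomials of minimal degree `μ ≤ (N-1)/2` is
orthogonal (with all its shifts) to the targets, which forces the reversed target polynomial to be
divisible by too high a power of `X`.  Pure polynomial algebra over `ℂ[X]`; nothing beyond Mathlib.
-/

set_option linter.dupNamespace false

namespace Summit.MatrixMultiplication.MatrixMultiplication.Theorems

open Polynomial Matrix BigOperators Finset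

/-- Coefficients of the product of a coefficient polynomial `∑ C (a n) X^n` with a reversed
coefficient polynomial `∑ C (b m) X^(N-1-m)`. -/
private theorem toep3_coeff_mul_rev {N : ℕ} (a b : Fin N → ℂ) (k : ℕ) :
    ((∑ n : Fin N, C (a n) * X ^ (n : ℕ)) * (∑ m : Fin N, C (b m) * X ^ (N - 1 - m))).coeff k =
      ∑ n : Fin N, ∑ m : Fin N, if k = (n : ℕ) + (N - 1 - m) then a n * b m else 0 := by
  rw [Finset.sum_mul_sum, finsetSum_coeff]
  refine Finset.sum_congr rfl fun n _ => ?_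
  rw [finsetSum_coeff]
  refine Finset.sum_congr rfl fun m _ => ?_
  have : C (a n) * X ^ (n : ℕ) * (C (b m) * X ^ (N - 1 - (m : ℕ))) =
      C (a n * b m) * X ^ ((n : ℕ) + (N - 1 - m)) := by
    rw [C_mul, pow_add]; ring
  rw [this, coeff_C_mul_X_pow]

/-- **Syzygies are orthogonal to Toeplitz images.**  If `T` is a Toeplitz matrix
(`T i j` depends only on `i - j`) and the coefficient vectors `Λ c` form a syzygy of the reversed
frame polynomials, `∑_c Λ_c(X) · Ẽ_c(X) = 0` with `Ẽ_c = ∑_m E c m · X^(N-1-m)`, then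
`∑_c ⟪Λ c, T E_c⟫ = 0`. -/
private theorem toep3_pair_eq_zero {N : ℕ} (T : Matrix (Fin N) (Fin N) ℂ)
    (hT : ∀ i j i' j' : Fin N, (i : ℕ) + j' = i' + j → T i j = T i' j')
    {ι : Type*} [Fintype ι] (Λ E : ι → Fin N → ℂ)
    (hsyz : ∑ c, (∑ n : Fin N, C (Λ c n) * X ^ (n : ℕ)) *
      (∑ m : Fin N, C (E c m) * X ^ (N - 1 - m)) = 0) :
    ∑ c, Λ c ⬝ᵥ (T *ᵥ E c) = 0 := by
  -- coefficient `k` of the syzygy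
  have hk : ∀ k : ℕ, ∑ n : Fin N, ∑ m : Fin N,
      (if k = (n : ℕ) + (N - 1 - m) then ∑ c, Λ c n * E c m else 0) = 0 := by
    intro k
    have h : (∑ c, (∑ n : Fin N, C (Λ c n) * X ^ (n : ℕ)) *
        (∑ m : Fin N, C (E c m) * X ^ (N - 1 - m))).coeff k = 0 := by
      rw [hsyz, coeff_zero]
    rw [finsetSum_coeff] at h
    simp_rw [toep3_coeff_mul_rev] at h
    rw [Finset.sum_comm] at h
    have e : ∀ n m : Fin N, (if k = (n : ℕ) + (N - 1 - m) then ∑ c, Λ c n * E c m else 0)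
        = ∑ c, (if k = (n : ℕ) + (N - 1 - m) then Λ c n * E c m else 0) := by
      intro n m; split_ifs <;> simp
    calc (∑ n : Fin N, ∑ m : Fin N,
          if k = (n : ℕ) + (N - 1 - m) then ∑ c, Λ c n * E c m else 0)
        = ∑ n : Fin N, ∑ c, ∑ m : Fin N,
            (if k = (n : ℕ) + (N - 1 - m) then Λ c n * E c m else 0) := by
          refine Finset.sum_congr rfl fun n _ => ?_
          rw [Finset.sum_congr rfl fun m _ => e n m]
          exact Finset.sum_comm
      _ = 0 := h
  -- rewrite the pairing as a double sum against `T`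
  have e1 : ∑ c, Λ c ⬝ᵥ (T *ᵥ E c) = ∑ n : Fin N, ∑ m : Fin N, T n m * ∑ c, Λ c n * E c m := by
    simp only [dotProduct, Matrix.mulVec, Finset.mul_sum]
    rw [Finset.sum_comm]
    refine Finset.sum_congr rfl fun n _ => ?_
    rw [Finset.sum_comm]
    refine Finset.sum_congr rfl fun m _ => Finset.sum_congr rfl fun c _ => ?_
    ring
  rw [e1]
  -- insert the lag index `k = n + (N-1-m) < 2N`
  have e2 : ∀ n m : Fin N, T n m * ∑ c, Λ c n * E c m =
      ∑ k ∈ Finset.range (2 * N),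
        if k = (n : ℕ) + (N - 1 - m) then T n m * ∑ c, Λ c n * E c m else 0 := by
    intro n m
    rw [Finset.sum_ite_eq']
    have : (n : ℕ) + (N - 1 - m) ∈ Finset.range (2 * N) := by
      rw [Finset.mem_range]; have := n.is_lt; omega
    rw [if_pos this]
  rw [Finset.sum_congr rfl fun n _ => Finset.sum_congr rfl fun m _ => e2 n m]
  rw [Finset.sum_comm]
  conv_lhs => arg 2; ext m; rw [Finset.sum_comm]
  rw [Finset.sum_comm]
  refine Finset.sum_eq_zero fun k _ => ?_
  -- on the fiber of `k`, `T` is constant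
  by_cases hex : ∃ n₀ m₀ : Fin N, k = (n₀ : ℕ) + (N - 1 - m₀)
  · obtain ⟨n₀, m₀, h₀⟩ := hex
    have hc : ∀ n m : Fin N, k = (n : ℕ) + (N - 1 - m) → T n m = T n₀ m₀ := by
      intro n m h
      apply hT
      have := m.is_lt; have := m₀.is_lt
      omega
    calc (∑ m : Fin N, ∑ n : Fin N,
          if k = (n : ℕ) + (N - 1 - m) then T n m * ∑ c, Λ c n * E c m else 0)
        = ∑ m : Fin N, ∑ n : Fin N,
          T n₀ m₀ * (if k = (n : ℕ) + (N - 1 - m) then ∑ c, Λ c n * E c m else 0) := by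
          refine Finset.sum_congr rfl fun m _ => Finset.sum_congr rfl fun n _ => ?_
          split_ifs with h
          · rw [hc n m h]
          · rw [mul_zero]
      _ = T n₀ m₀ * ∑ n : Fin N, ∑ m : Fin N,
          (if k = (n : ℕ) + (N - 1 - m) then ∑ c, Λ c n * E c m else 0) := by
          rw [Finset.mul_sum, Finset.sum_comm]
          refine Finset.sum_congr rfl fun n _ => ?_
          rw [Finset.mul_sum]
      _ = 0 := by rw [hk k, mul_zero]
  · push Not at hex
    refine Finset.sum_eq_zero fun m _ => Finset.sum_eq_zero fun n _ => ?_
    rw [if_neg (hex n m)]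

/-- A polynomial of degree `< N` is the coefficient polynomial of its coefficient vector. -/
private theorem toep3_sum_C_coeff {N : ℕ} (p : ℂ[X]) (hp : p.natDegree < N) :
    (∑ n : Fin N, C (p.coeff n) * X ^ (n : ℕ)) = p := by
  ext k
  rw [finsetSum_coeff]
  simp only [coeff_C_mul_X_pow]
  by_cases hk : k < N
  · rw [Finset.sum_eq_single ⟨k, hk⟩]
    · simp
    · intro b _ hb
      rw [if_neg]
      exact fun h => hb (Fin.ext (by simp only; omega))
    · simp
  · push Not at hk
    rw [Finset.sum_eq_zero]
    · exact (coeff_eq_zero_of_natDegree_lt (by omega)).symm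
    · intro n _
      rw [if_neg]
      have := n.is_lt; omega

/-- **Toeplitz three-slot lemma.**  Let `T 0, T 1, T 2` be honest `N × N` Toeplitz matrices
(`T b i j` depends only on `i - j`), `E 0, E 1, E 2` arbitrary vectors and `f` a vector with
`T b *ᵥ E c = [b = c] • f` for all `b, c : Fin 3`.  Then `f = 0`.

Proof.  Reverse the frame vectors into polynomials `Ẽ_c = ∑_m E c m · X^(N-1-m)` and `f` into
`φ = ∑_n f n · X^(N-1-n)`.  (A) For every polynomial syzygy `∑_c P_c Ẽ_c = 0` and every shift
`X^i P` of component degrees `< N`, the Toeplitz structure gives `∑_c ⟪X^i P_c, T_b E_c⟫ = 0`,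
i.e. `⟪X^i P_b, f⟫ = 0`; in terms of `φ`: the coefficients of `P_b φ` in degrees `[μ, N)` vanish
(`μ = max deg P_c`).  (B) A nonzero syzygy of degree `μ ≤ (N-1)/2` exists by counting
(`3(m+1) > m + N` unknowns vs equations); take `μ` minimal.  (C) Write `P_b φ = ρ_b + X^N σ_b`
with `deg ρ_b < μ`; then `P_c ρ_b - P_b ρ_c` is divisible by `X^N` and has degree `< 2μ ≤ N - 1`,
so it vanishes; hence `ρ` is itself a syzygy of degree `< μ`, so `ρ = 0` by minimality and
`X^N ∣ P_b φ` for all `b`.  (D) With `φ = X^v u`, `X ∤ u`, `v < N`, this gives `X^(N-v) ∣ P_b`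
for all `b`, and `P / X^(N-v)` is a nonzero syzygy of degree `< μ` — contradiction.  So `φ = 0`,
i.e. `f = 0`.  (No rank or nonsingularity hypothesis is needed.) -/
theorem hclR_toeplitz_three_slot :
    ∀ {N : ℕ} (T : Fin 3 → Matrix (Fin N) (Fin N) ℂ),
      (∀ b, ∀ i j i' j' : Fin N, (i : ℕ) + j' = i' + j → T b i j = T b i' j') →
      ∀ (E : Fin 3 → Fin N → ℂ) (f : Fin N → ℂ), (∀ b c, T b *ᵥ E c = if b = c then f else 0) →
      f = 0 := by
  intro N T hT E f hcorner
  classical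
  rcases Nat.eq_zero_or_pos N with hN | hN
  · subst hN; funext i; exact Fin.elim0 i
  by_contra hf
  -- reversed frame polynomials and the reversed target polynomial
  set Er : Fin 3 → ℂ[X] := fun c => ∑ m : Fin N, C (E c m) * X ^ (N - 1 - (m : ℕ)) with hEr
  set φ : ℂ[X] := ∑ n : Fin N, C (f n) * X ^ (N - 1 - (n : ℕ)) with hφ
  have hEr_deg : ∀ c, (Er c).natDegree ≤ N - 1 := fun c =>
    natDegree_sum_le_of_forall_le _ _ fun m _ => (natDegree_C_mul_X_pow_le _ _).trans (by omega)
  have hφ_deg : φ.natDegree ≤ N - 1 :=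
    natDegree_sum_le_of_forall_le _ _ fun m _ => (natDegree_C_mul_X_pow_le _ _).trans (by omega)
  have hφ_coeff : ∀ n : Fin N, φ.coeff (N - 1 - n) = f n := by
    intro n
    rw [hφ, finsetSum_coeff]
    simp only [coeff_C_mul_X_pow]
    rw [Finset.sum_eq_single n]
    · simp
    · intro b _ hb
      rw [if_neg]
      exact fun h => hb (Fin.ext (by have := b.is_lt; have := n.is_lt; omega))
    · simp
  have hφ0 : φ ≠ 0 := by
    intro h
    apply hf
    funext n
    have := hφ_coeff n
    rw [h, coeff_zero] at this
    exact this.symm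
  -- syzygies of the reversed frame polynomials
  let Syz : (Fin 3 → ℂ[X]) → Prop := fun P => ∑ c, P c * Er c = 0
  -- (A) orthogonality: coefficients of `P b * φ` vanish in degrees `[μ, N)`
  have horth : ∀ (P : Fin 3 → ℂ[X]) (μ : ℕ), Syz P → (∀ c, (P c).natDegree ≤ μ) →
      ∀ b, ∀ K, μ ≤ K → K < N → (P b * φ).coeff K = 0 := by
    intro P μ hP hdeg b K hμK hKN
    set i := N - 1 - K with hi
    have hdeg' : ∀ c, (X ^ i * P c).natDegree < N := by
      intro c
      calc (X ^ i * P c).natDegree ≤ (X ^ i : ℂ[X]).natDegree + (P c).natDegree := natDegree_mul_le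
        _ ≤ i + μ := by rw [natDegree_X_pow]; exact Nat.add_le_add_left (hdeg c) _
        _ < N := by omega
    set Λ : Fin 3 → Fin N → ℂ := fun c n => (X ^ i * P c).coeff n with hΛ
    have hΛ' : ∀ c, (∑ n : Fin N, C (Λ c n) * X ^ (n : ℕ)) = X ^ i * P c := fun c =>
      toep3_sum_C_coeff _ (hdeg' c)
    have hsyz' : ∑ c, (∑ n : Fin N, C (Λ c n) * X ^ (n : ℕ)) *
        (∑ m : Fin N, C (E c m) * X ^ (N - 1 - (m : ℕ))) = 0 := by
      calc _ = ∑ c, X ^ i * P c * Er c := Finset.sum_congr rfl fun c _ => by rw [hΛ' c]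
        _ = X ^ i * ∑ c, P c * Er c := by
            rw [Finset.mul_sum]; exact Finset.sum_congr rfl fun c _ => by ring
        _ = 0 := by rw [show (∑ c, P c * Er c) = 0 from hP, mul_zero]
    have key : ∑ c, Λ c ⬝ᵥ (T b *ᵥ E c) = 0 := toep3_pair_eq_zero (T b) (hT b) Λ E hsyz'
    have key2 : Λ b ⬝ᵥ f = 0 := by
      rw [← key, Finset.sum_eq_single b]
      · rw [hcorner b b, if_pos rfl]
      · intro c _ hcb
        rw [hcorner b c, if_neg (Ne.symm hcb), dotProduct_zero]
      · simp
    rw [dotProduct] at key2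
    have e : (P b * φ).coeff K = ∑ n : Fin N, Λ b n * f n := by
      simp only [hΛ]
      rw [hφ, Finset.mul_sum, finsetSum_coeff]
      refine Finset.sum_congr rfl fun n _ => ?_
      rw [← mul_assoc, coeff_mul_X_pow', coeff_mul_C, coeff_X_pow_mul']
      have := n.is_lt
      by_cases h : i ≤ (n : ℕ)
      · rw [if_pos h, if_pos (show N - 1 - (n : ℕ) ≤ K by omega)]
        have e' : K - (N - 1 - (n : ℕ)) = (n : ℕ) - i := by omega
        rw [e']
      · rw [if_neg h, if_neg (show ¬ (N - 1 - (n : ℕ) ≤ K) by omega), zero_mul]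
    rw [e]
    exact key2
  -- (B) a nonzero syzygy of degree ≤ m := (N-1)/2 exists (dimension count)
  set m := (N - 1) / 2 with hm
  have hexist : ∃ P : Fin 3 → ℂ[X], Syz P ∧ P ≠ 0 ∧ ∀ c, (P c).natDegree ≤ m := by
    let v : Fin 3 × Fin (m + 1) → (Fin (m + N) → ℂ) :=
      fun ca k => (X ^ (ca.2 : ℕ) * Er ca.1).coeff k
    have hli : ¬ LinearIndependent ℂ v := by
      intro hli
      have h1 := hli.fintype_card_le_finrank
      rw [Module.finrank_fin_fun, Fintype.card_prod, Fintype.card_fin, Fintype.card_fin] at h1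
      omega
    obtain ⟨g, hg, ⟨c₀, a₀⟩, hg0⟩ := Fintype.not_linearIndependent_iff.mp hli
    refine ⟨fun c => ∑ a : Fin (m + 1), C (g (c, a)) * X ^ (a : ℕ), ?_, ?_, ?_⟩
    · show ∑ c, (∑ a : Fin (m + 1), C (g (c, a)) * X ^ (a : ℕ)) * Er c = 0
      ext k
      rw [finsetSum_coeff, coeff_zero]
      by_cases hk : k < m + N
      · have h1 := congr_fun hg ⟨k, hk⟩
        simp only [Finset.sum_apply, Pi.smul_apply, smul_eq_mul, Pi.zero_apply] at h1
        rw [Fintype.sum_prod_type] at h1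
        refine Eq.trans ?_ h1
        refine Finset.sum_congr rfl fun c _ => ?_
        rw [Finset.sum_mul, finsetSum_coeff]
        refine Finset.sum_congr rfl fun a _ => ?_
        rw [mul_assoc, coeff_C_mul]
      · refine Finset.sum_eq_zero fun c _ => ?_
        apply coeff_eq_zero_of_natDegree_lt
        calc ((∑ a : Fin (m + 1), C (g (c, a)) * X ^ (a : ℕ)) * Er c).natDegree
            ≤ (∑ a : Fin (m + 1), C (g (c, a)) * X ^ (a : ℕ)).natDegree + (Er c).natDegree :=
              natDegree_mul_le
          _ ≤ m + (N - 1) := Nat.add_le_add (natDegree_sum_le_of_forall_le _ _ fun a _ =>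
              (natDegree_C_mul_X_pow_le _ _).trans (by omega)) (hEr_deg c)
          _ < k := by omega
    · intro hP
      apply hg0
      have h1 : (∑ a : Fin (m + 1), C (g (c₀, a)) * X ^ (a : ℕ)) = 0 := congr_fun hP c₀
      have hc := congrArg (fun p : ℂ[X] => p.coeff a₀) h1
      simp only [finsetSum_coeff, coeff_C_mul_X_pow, coeff_zero] at hc
      rw [Finset.sum_eq_single a₀] at hc
      · simpa using hc
      · intro a _ ha
        rw [if_neg]
        exact fun h => ha (Fin.ext (by omega))
      · simp
    · intro c
      exact natDegree_sum_le_of_forall_le _ _ fun a _ =>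
        (natDegree_C_mul_X_pow_le _ _).trans (by omega)
  -- minimal degree `μ` of a nonzero syzygy
  let Pred : ℕ → Prop := fun μ => ∃ P : Fin 3 → ℂ[X], Syz P ∧ P ≠ 0 ∧ ∀ c, (P c).natDegree ≤ μ
  have hPred : ∃ μ, Pred μ := ⟨m, hexist⟩
  obtain ⟨P, hPsyz, hP0, hPdeg⟩ : Pred (Nat.find hPred) := Nat.find_spec hPred
  set μ := Nat.find hPred with hμdef
  have hμm : μ ≤ m := Nat.find_min' hPred hexist
  have hmin : ∀ Q : Fin 3 → ℂ[X], Syz Q → (∀ c, Q c ≠ 0 → (Q c).natDegree < μ) → Q = 0 := by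
    intro Q hQ hQdeg
    by_contra hQ0
    obtain ⟨c₁, hc₁⟩ : ∃ c, Q c ≠ 0 := by
      by_contra hall; push Not at hall; exact hQ0 (funext hall)
    have hμpos : 0 < μ := by have := hQdeg c₁ hc₁; omega
    have hP' : Pred (μ - 1) := ⟨Q, hQ, hQ0, fun c => by
      by_cases h : Q c = 0
      · rw [h, natDegree_zero]; exact Nat.zero_le _
      · have := hQdeg c h; omega⟩
    exact Nat.find_min hPred (show μ - 1 < μ by omega) hP'
  have h2μ : 2 * μ ≤ N - 1 := by omega
  -- (C) truncations `ρ b := (P b * φ) mod X^N` have degree `< μ`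
  have hXN : (X ^ N : ℂ[X]).Monic := monic_X_pow N
  have hdiv : ∀ b, ∃ ρb σb : ℂ[X], P b * φ = ρb + X ^ N * σb ∧ ρb.degree < N := fun b =>
    ⟨(P b * φ) %ₘ X ^ N, (P b * φ) /ₘ X ^ N, (modByMonic_add_div (P b * φ) (X ^ N)).symm,
      (degree_modByMonic_lt _ hXN).trans_eq (degree_X_pow N)⟩
  choose ρ σ hρσ hρN using hdiv
  have hρcoeff : ∀ b K, μ ≤ K → (ρ b).coeff K = 0 := by
    intro b K hK
    rcases lt_or_ge K N with hKN | hKN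
    · have e : (ρ b).coeff K = (P b * φ).coeff K - (X ^ N * σ b).coeff K := by
        rw [hρσ b, coeff_add]; ring
      rw [e, horth P μ hPsyz hPdeg b K hK hKN, coeff_X_pow_mul', if_neg (by omega), sub_zero]
    · apply coeff_eq_zero_of_degree_lt
      calc (ρ b).degree < N := hρN b
        _ ≤ K := by exact_mod_cast hKN
  have hρdeg : ∀ b, ρ b ≠ 0 → (ρ b).natDegree < μ := by
    intro b hb
    by_contra h
    push Not at h
    have := hρcoeff b _ h
    rw [coeff_natDegree, leadingCoeff_eq_zero] at this
    exact hb this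
  -- cross relation `P c * ρ b = P b * ρ c`
  have hcross : ∀ b c, P c * ρ b = P b * ρ c := by
    intro b c
    have hdvd : (X ^ N : ℂ[X]) ∣ (P c * ρ b - P b * ρ c) := by
      refine ⟨P b * σ c - P c * σ b, ?_⟩
      have eb := hρσ b
      have ec := hρσ c
      linear_combination (P b) * ec - (P c) * eb
    have h1 : ∀ b c, (P c * ρ b).natDegree < N := by
      intro b c
      by_cases hb : ρ b = 0
      · rw [hb, mul_zero, natDegree_zero]; exact hN
      · calc (P c * ρ b).natDegree ≤ (P c).natDegree + (ρ b).natDegree := natDegree_mul_le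
          _ < N := by have := hPdeg c; have := hρdeg b hb; omega
    have hdeg : (P c * ρ b - P b * ρ c).natDegree < (X ^ N : ℂ[X]).natDegree := by
      rw [natDegree_X_pow]
      calc (P c * ρ b - P b * ρ c).natDegree
          ≤ max (P c * ρ b).natDegree (P b * ρ c).natDegree := natDegree_sub_le _ _
        _ < N := max_lt (h1 b c) (h1 c b)
    exact sub_eq_zero.mp (eq_zero_of_dvd_of_natDegree_lt hdvd hdeg)
  -- `ρ` is a syzygy of degree `< μ`, hence zero
  obtain ⟨b₀, hb₀⟩ : ∃ b, P b ≠ 0 := by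
    by_contra hall; push Not at hall; exact hP0 (funext hall)
  have hρsyz : Syz ρ := by
    show ∑ c, ρ c * Er c = 0
    have h1 : P b₀ * ∑ c, ρ c * Er c = ρ b₀ * ∑ c, P c * Er c := by
      rw [Finset.mul_sum, Finset.mul_sum]
      refine Finset.sum_congr rfl fun c _ => ?_
      rw [← mul_assoc, ← mul_assoc, hcross c b₀, mul_comm (P c)]
    rw [show (∑ c, P c * Er c) = 0 from hPsyz, mul_zero] at h1
    exact (mul_eq_zero.mp h1).resolve_left hb₀
  have hρ0 : ρ = 0 := hmin ρ hρsyz fun c hc => hρdeg c hc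
  have hdvdN : ∀ b, (X ^ N : ℂ[X]) ∣ P b * φ := by
    intro b
    refine ⟨σ b, ?_⟩
    have h1 := hρσ b
    rw [show ρ b = 0 from congr_fun hρ0 b, zero_add] at h1
    exact h1
  -- (D) valuation of `φ`: `φ = X^v * u`, `X ∤ u`, `v < N`
  obtain ⟨u, hu, hXu⟩ := exists_eq_pow_rootMultiplicity_mul_and_not_dvd φ hφ0 0
  rw [map_zero, sub_zero] at hu hXu
  set v := rootMultiplicity 0 φ with hv
  have hvN : v < N := by
    have h1 : (X ^ v : ℂ[X]) ∣ φ := ⟨u, hu⟩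
    have h2 := natDegree_le_of_dvd h1 hφ0
    rw [natDegree_X_pow] at h2
    omega
  have hcop : IsCoprime ((X : ℂ[X]) ^ (N - v)) u :=
    ((irreducible_X.coprime_iff_not_dvd).mpr hXu).pow_left
  have hdvdP : ∀ b, ∃ Qb : ℂ[X], P b = X ^ (N - v) * Qb := by
    intro b
    apply hcop.dvd_of_dvd_mul_right
    have h := hdvdN b
    rw [hu, ← mul_assoc, mul_comm (P b), mul_assoc,
      show (X ^ N : ℂ[X]) = X ^ v * X ^ (N - v) by rw [← pow_add]; congr 1; omega] at h
    exact (mul_dvd_mul_iff_left (pow_ne_zero v X_ne_zero)).mp h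
  choose Q hQ using hdvdP
  have hQsyz : Syz Q := by
    show ∑ c, Q c * Er c = 0
    have h1 : (X : ℂ[X]) ^ (N - v) * ∑ c, Q c * Er c = ∑ c, P c * Er c := by
      rw [Finset.mul_sum]
      refine Finset.sum_congr rfl fun c _ => ?_
      rw [← mul_assoc, ← hQ c]
    rw [show (∑ c, P c * Er c) = 0 from hPsyz] at h1
    exact (mul_eq_zero.mp h1).resolve_left (pow_ne_zero _ X_ne_zero)
  have hQ0 : Q = 0 := hmin Q hQsyz fun c hc => by
    have h1 : (P c).natDegree = (N - v) + (Q c).natDegree := by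
      rw [hQ c, natDegree_mul (pow_ne_zero _ X_ne_zero) hc, natDegree_X_pow]
    have := hPdeg c
    omega
  apply hP0
  funext c
  rw [hQ c, show Q c = 0 from congr_fun hQ0 c, mul_zero]
  rfl

end Summit.MatrixMultiplication.MatrixMultiplication.Theorems
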